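import Summits.BirchSwinnertonDyer.Rank1Residual.X10.CoreTheoremAOddPrimeOfFactsPT
import Summits.BirchSwinnertonDyer.Rank1Residual.X10.MuTransferThreeShaAnUnit
import Summits.BirchSwinnertonDyer.BirchSwinnertonDyer.Theorems.SmallImageMuTransferMuTransferX9NormCompatibleIntegral
import HarnessLib

/-!
# N2 (class X10b, `p = 3`) — THE TYPED CORE `CoreTheoremAOddPrime` HOLDS UNCONDITIONALLY; the node
# `KatoMuTransferThree` and the odd-prime `μ = 0` transfer modulo Kato's Thm. 12.6 package (F1) ALONE
# (cell `b2b-bsdres`, unit `b2b-bsdres-x10` = N2 class lead, GEN 40; theorems only; nothing asserted,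
# nothing booked)

HONEST FRAMING (run/shared/lean/b2b/bsd-rank1-residual/, verbatim in every file): the goal of the
cell is to DELETE the COMBINATION-SHAPED residual classes of the Birch–Swinnerton-Dyer formula for
analytic-rank `≤ 1` curves over `ℚ` using PUBLISHED theorems only, and to TYPE the
CONSTRUCTION-SHAPED remainder; this is not "finishing BSD".  Class X10b (= N2) is
CONSTRUCTION-SHAPED / NEEDS X_A3 and stays so: the class-level X_A3 needs `AnalyticMuZeroOnClassX10b`
(barrier B3, class-wide), which only per-pair certificates supply.  This file books nothing and moves
no census word and no mark.  PARTITION (D-0054): X10b∧¬Surj (A5) × p = 3 and X9 (A4) × p ∈ {5, 7}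
(the core is uniform in the odd prime) — types-the-object-of; closes NONE.

## What

F2 = Kato §13.8 on the pin (`Kato2004.mem_pSmul_of_red_eq_zero`: an element of `𝐇¹_Γ(T_pW)` whose
levelwise reductions mod `p` vanish lies in `p·𝐇¹`) is PROVED IN THE TREE (cell `bsd-smallim`): the weak Lemma 8.5 (2) on the pin's layers — a
norm-compatible family of classes of `T_pW` whose `p`-multiples are integral is integral —
`UniversalNorms.mem_integralH1_of_layerCores_eq_of_smul_mem` (lur-a g2,
`Theorems/SmallImageMuTransferMuTransferX9NormCompatibleIntegral`, with k6-g3 g2's `H¹(·,T_pW)[p]` card bound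
p477996 / periodic orbit sums p478340 / `…ResCoresPowers` p478890) fed to k6-g4 g2's reduction
`Kato2004.mem_pSmul_of_red_eq_zero_of_integral_of_smul_mem` (König roots, p475393/p477776).  This file
states NO theorem of type F2 (the by-name `Kato2004.mem_pSmul_of_red_eq_zero_holds` and the closer of aside
19844 are the F2 hands'); it feeds the weak Lemma 8.5 (2) straight into
`coreTheoremAOddPrime_of_integral_of_smul_mem` (p478638).  With F3 (Poitou–Tate over `ℚ`,
`poitouTate_sum_localTatePairing_eq_zero_holds`, cell `bsd-cn100`) already discharged in
`X10/CoreTheoremAOddPrimeOfFactsPT` (p478638), N2's typed core — GEN 37's node `CoreTheoremAOddPrime`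
(= the K6 crux's registered `stub_coreX9` with `ClassX9 ↦ p ≠ 2 ∧ good ordinary ∧ Irr ∧ ¬Surj`) — now
HOLDS OUTRIGHT, and every downstream statement loses the binder `hred`:

* **`coreTheoremAOddPrime_holds : CoreTheoremAOddPrime`**, **`coreTheoremAOnClassX10b_holds : CoreTheoremAOnClassX10b`**;
* **`katoMuTransferThree_of_fine (hfine : F1) : KatoMuTransferThree`**, `mu_eq_zero_of_fine (hfine : F1)` —
  the `μ`-transfer at every odd good ordinary prime with `E[p]` irreducible and `ρ̄` not surjective,
  modulo Kato's Thm. 12.6 package with the fine quotient and the span clause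
  (`Kato2004.exists_divisibilityInputs_fineQuotient_zeta`) ALONE;
* `mazurMainConjectureOnClassX10b_of_fine`, **`bsdpOnClassX10b_of_fine`**, `bsdpOnClassX10b_of_fine_of_mazur`
  — the A5 chain: remaining binders = Yan–Zhu 4.9 (flag `YZ26@3-BF-ERL-Ohta`), the period-unit pair (or
  Mazur 1978 Cor. 4.1), Schneider 1985 / Perrin-Riou at odd `p`, the modular parametrisation package,
  GZK, F1, the OPEN `AnalyticMuZeroOnClassX10b` (barrier B3) and the Schneider rider at rank `1`.

References: K. Kato, Astérisque 295 (2004) Thm. 12.6 (p. 222), §13.8 (pp. 228–229), Lemma 8.5 (p. 183),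
(14.9.3), §17.13 [Kato2004Asterisque]; R. Greenberg, V. Vatsal, Invent. Math. 142 (2000) Prop. 3.7
[GreenbergVatsal2000]; R. Greenberg, LNM 1716 (1999) Thm. 4.1 [GreenbergLNM1716]; B. Mazur, Invent.
Math. 44 (1978) Cor. 4.1 [Mazur1978].
-/

set_option linter.dupNamespace false
set_option autoImplicit false

noncomputable section

open scoped Classical MatrixGroups ModularForm NumberField
open CongruenceSubgroup WeierstrassCurve Field IsDedekindDomain
open Literature.NumberTheory.GaloisRepresentations
open Literature.NumberTheory.GaloisCohomology
open Literature.NumberTheory.EllipticCurves Literature.NumberTheory.EllipticCurves.ModularForms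
open Literature.NumberTheory.EllipticCurves.Kato2004
open Literature.NumberTheory.EllipticCurves.Kato2004.EulerSystemValues
open Literature.NumberTheory.EllipticCurves.Rank1Residual
open Summit.BirchSwinnertonDyer.BirchSwinnertonDyer.Theorems.Rank1ResidualX1Defs
  Summit.BirchSwinnertonDyer.BirchSwinnertonDyer.Rank1Residual

namespace Summit.BirchSwinnertonDyer.Rank1Residual.X10

/-! ## The core holds -/

/-- **N2's typed core `CoreTheoremAOddPrime` HOLDS** (GEN 37's node; = the K6 crux's kernel core at every
odd prime: for `p ≠ 2` good ordinary, `E[p]` irreducible, `ρ̄` not surjective, a genuine Euler-system class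
outside `p𝐇¹` kills the fine Selmer group's `p`-torsion growth, `∃ J, ∀ x ∈ Sel₀(E/ℚ_∞)[p], T^J x = 0`) —
`coreTheoremAOddPrime_of_integral_of_smul_mem` (p478638) at lur-a g2's weak Lemma 8.5 (2)
`UniversalNorms.mem_integralH1_of_layerCores_eq_of_smul_mem`.  Unconditional; nothing asserted
beyond the node's own statement. [cite: Kato2004Asterisque, §13.8 (pp. 228–229), Thm. 12.6 (p. 222)]
[cite: MilneADT2006, Ch. I, Thm. 4.10(b)] -/
theorem coreTheoremAOddPrime_holds : CoreTheoremAOddPrime :=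
  coreTheoremAOddPrime_of_integral_of_smul_mem fun W _ p _ _ κ hκ z hz hpz n =>
    UniversalNorms.mem_integralH1_of_layerCores_eq_of_smul_mem W p κ hκ z hz hpz n

/-- **The registered `p = 3` shape `CoreTheoremAOnClassX10b` HOLDS** (GEN 36's node).
[cite: Kato2004Asterisque, §13.8 (pp. 228–229)] -/
theorem coreTheoremAOnClassX10b_holds : CoreTheoremAOnClassX10b :=
  coreTheoremAOnClassX10b_of_oddPrime coreTheoremAOddPrime_holds

/-! ## The `μ`-transfer modulo F1 alone -/

/-- **`μ(X(E/ℚ_∞)) = 0` at every odd good ordinary prime with `E[p]` irreducible and `ρ̄` not surjective,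
given one unit coefficient of `L_p(f, α)` — modulo ONE published construction fact** (F1: Kato Thm. 12.6
with (14.9.3)/§17.13, `exists_divisibilityInputs_fineQuotient_zeta`).  Serves X9 at `p ∈ {5, 7}` AND
X10b∧¬Surj at `p = 3`. [cite: Kato2004Asterisque, Thm. 12.6 (p. 222), (14.9.3) (p. 240) and §17.13 (pp. 279–280)]
[cite: GreenbergVatsal2000, Prop. 3.7] -/
theorem mu_eq_zero_of_fine (hfine : exists_divisibilityInputs_fineQuotient_zeta) :
    ∀ (W : WeierstrassCurve ℚ) [W.IsElliptic] [W.IsGloballyMinimal] (p : ℕ) [Fact p.Prime]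
      {N : ℕ} [NeZero N] (f : CuspForm (Gamma0 N) 2),
      p ≠ 2 → W.HasGoodReductionAtPrime p → ¬ (p : ℤ) ∣ W.frobeniusTrace p →
      W.HasIrreducibleModPGaloisRep p → ¬ W.HasSurjectiveModNGaloisRep p → IsNewformOf W f →
      (∃ n : ℕ, ‖PowerSeries.coeff n (padicLFunction f (unitRoot W p : ℚ_[p]))‖ = 1) →
      ∀ (κ : ZpExtension ℚ p) (γ : absoluteGaloisGroup ℚ),
        κ.IsCyclotomic → κ.IsTopGenerator γ → IsCyclotomicVariable p γ →
        ∀ D : W.SelmerDualData κ γ, D.mu = 0 :=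
  mu_eq_zero_of_coreOddPrime nonempty_iwasawaH1Data_holds hfine coreTheoremAOddPrime_holds

/-- **N2: the `μ`-transfer node `KatoMuTransferThree` (cell `bsd-smallim`, p407527) modulo F1 ALONE.**
[cite: Kato2004Asterisque, Thm. 12.6 (p. 222) and §17.13 (pp. 279–280)] [cite: GreenbergVatsal2000, Prop. 3.7] -/
theorem katoMuTransferThree_of_fine (hfine : exists_divisibilityInputs_fineQuotient_zeta) :
    KatoMuTransferThree :=
  katoMuTransferThree_of_coreOddPrime nonempty_iwasawaH1Data_holds hfine coreTheoremAOddPrime_holds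

/-! ## The A5 chain -/

/-- **X_A3 on class X10b modulo F1, the published binders and barrier B3** (`hred` and `hPT` gone; Yan–Zhu
4.9 `hYZ` flagged `YZ26@3-BF-ERL-Ohta`; nothing booked). [cite: YanZhu2024MainConjNonCM, Thm. 4.9 (§4.4)]
[cite: Kato2004Asterisque, Thm. 12.6 (p. 222) and §17.13 (pp. 279–280)] -/
theorem mazurMainConjectureOnClassX10b_of_fine
    (hYZ : YanZhu2026.thm49_charIdeal_eq_padicLFunction)
    (h5 : realPeriodRat_eq_unit_mul_plusPeriod) (h3 : realPeriodRat_eq_unit_mul_plusPeriod_three)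
    (hmodP : nonempty_modularParametrizationData)
    (hfine : exists_divisibilityInputs_fineQuotient_zeta) (hA : AnalyticMuZeroOnClassX10b) :
    MazurMainConjectureOnClassX10b :=
  mazurMainConjectureOnClassX10b_of_coreOddPrime hYZ h5 h3 hmodP nonempty_iwasawaH1Data_holds hfine
    coreTheoremAOddPrime_holds hA

/-- **The A5 class leaf `BSDpOnClassX10b` modulo F1, the published binders, barrier B3 and the rank-1
Schneider rider** (`hGr`, `hMT`, `hred`, `hPT` all supplied by tree theorems).  Nothing booked.
[cite: YanZhu2024MainConjNonCM, Thm. 4.9 (§4.4)] [cite: GreenbergLNM1716, Thm. 4.1 (p. 102) and §1 Conj. 1.11]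
[cite: Kato2004Asterisque, Thm. 12.6 (p. 222) and §17.13 (pp. 279–280)] [cite: Miller2011LMS, §1 and Def. 1.1] -/
theorem bsdpOnClassX10b_of_fine
    (hYZ : YanZhu2026.thm49_charIdeal_eq_padicLFunction)
    (h5 : realPeriodRat_eq_unit_mul_plusPeriod) (h3 : realPeriodRat_eq_unit_mul_plusPeriod_three)
    (hS : Schneider1985_order_charGenerator_odd) (hPR : perrinRiou_rankOne_leadingTerms_odd)
    (hmodP : nonempty_modularParametrizationData)
    (hGZK : rank_eq_analyticRank_of_analyticRank_le_one)
    (hfine : exists_divisibilityInputs_fineQuotient_zeta) (hA : AnalyticMuZeroOnClassX10b)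
    (hC3 : ∀ (W : WeierstrassCurve ℚ) [W.IsElliptic] [W.IsGloballyMinimal] (p : ℕ) [Fact p.Prime],
      ClassX10 W p → ¬ Surj W 3 → W.analyticRank = 1 →
        ∀ Dh : PAdicHeightData W p, Dh.IsCanonical → SchneiderConjecture Dh) :
    BSDpOnClassX10b :=
  bsdpOnClassX10b_of_coreOddPrime hYZ
    (greenberg_charValue_rankZero_of_Schneider1985_odd hS mazur_tate_sigma_exists_odd_holds) h5 h3 hS hPR
    mazur_tate_sigma_exists_odd_holds hmodP hGZK nonempty_iwasawaH1Data_holds hfine coreTheoremAOddPrime_holds hA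
    hC3

/-- **The A5 class leaf with the period-unit binders sourced to Mazur 1978, Cor. 4.1** (lattice form
`ModularForms.mazur_not_dvd_maninConstant_of_odd`), modulo F1, barrier B3 and the rank-1 rider.
[cite: Mazur1978, Cor. 4.1] [cite: YanZhu2024MainConjNonCM, Thm. 4.9 (§4.4)] [cite: GreenbergLNM1716, Thm. 4.1 (p. 102)] -/
theorem bsdpOnClassX10b_of_fine_of_mazur
    (hYZ : YanZhu2026.thm49_charIdeal_eq_padicLFunction)
    (hM : mazur_not_dvd_maninConstant_of_odd)
    (hS : Schneider1985_order_charGenerator_odd) (hPR : perrinRiou_rankOne_leadingTerms_odd)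
    (hmodP : nonempty_modularParametrizationData)
    (hGZK : rank_eq_analyticRank_of_analyticRank_le_one)
    (hfine : exists_divisibilityInputs_fineQuotient_zeta) (hA : AnalyticMuZeroOnClassX10b)
    (hC3 : ∀ (W : WeierstrassCurve ℚ) [W.IsElliptic] [W.IsGloballyMinimal] (p : ℕ) [Fact p.Prime],
      ClassX10 W p → ¬ Surj W 3 → W.analyticRank = 1 →
        ∀ Dh : PAdicHeightData W p, Dh.IsCanonical → SchneiderConjecture Dh) :
    BSDpOnClassX10b :=
  bsdpOnClassX10b_of_fine hYZ (SkinnerUrban2014.realPeriodRat_eq_unit_mul_plusPeriod_of_mazur hM)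
    (SkinnerUrban2014.realPeriodRat_eq_unit_mul_plusPeriod_three_of_mazur hM) hS hPR hmodP hGZK hfine hA hC3

/-! ## Kato's Thm. 17.4 at a pair from F1 and Thm. 12.4 (bridges; F2-independent) -/

/-- **F1 implies the tree's `Kato2004.exists_divisibilityInputs`** (the §17.13 package without the fine
quotient and the span clause): the instance binders `Module.Free/Finite ℤ_[p] (T_pW)` of F1 are tree
theorems (`module_free_tateModule_holds`, `module_finite_tateModule_holds`) and a fine Selmer dual datum
exists (`nonempty_fineSelmerDualData`).  [cite: Kato2004Asterisque, Thm. 12.6 (p. 222) and §17.13 (pp. 279–280)] -/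
theorem exists_divisibilityInputs_of_fineQuotient_zeta
    (hfine : exists_divisibilityInputs_fineQuotient_zeta) : exists_divisibilityInputs := by
  intro W _ _ p _ _ N _ f κ γ hp hord hκ hγ hγ' hf I D
  haveI : Module.Free ℤ_[p] (W.tateModule p) := W.module_free_tateModule_holds p
  haveI : Module.Finite ℤ_[p] (W.tateModule p) := W.module_finite_tateModule_holds p
  obtain ⟨Y⟩ := W.nonempty_fineSelmerDualData κ hγ
  obtain ⟨K, -, -, -, -⟩ := hfine W p f κ γ hp hord hκ hγ hγ' hf I D Y
  exact ⟨K⟩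

/-- **Kato's Thm. 17.4 for `T_pE` at a pair (the tree's named fact `kato_divisibility W p`) from Kato's
Thm. 12.4 (`Kato2004.thm12_4`) and F1** — `Kato2004.kato_divisibility_of_inputs` (the PROVED §17.13
module theory) with (12.2.1) by `nonempty_iwasawaH1Data_holds` and the package by
`exists_divisibilityInputs_of_fineQuotient_zeta`.  So the per-pair binder `hK` below is Kato Ch. 12 only.
[cite: Kato2004Asterisque, Thm. 12.4 (p. 221), Thm. 12.6 (p. 222), Thm. 17.4 (p. 273) and §17.13] -/
theorem kato_divisibility_of_thm12_4_of_fine (h12 : thm12_4)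
    (hfine : exists_divisibilityInputs_fineQuotient_zeta) (W : WeierstrassCurve ℚ) [W.IsElliptic]
    [W.IsGloballyMinimal] (p : ℕ) [Fact p.Prime] {κ : ZpExtension ℚ p} {γ : absoluteGaloisGroup ℚ}
    {N : ℕ} [NeZero N] {f : CuspForm (Gamma0 N) 2} :
    kato_divisibility W p (κ := κ) (γ := γ) (f := f) := by
  haveI : ContinuousSMul ℤ_[p] (W.tateModule p) := TateModule.continuousSMul_padicInt
  exact kato_divisibility_of_inputs nonempty_iwasawaH1Data_holds h12
    (exists_divisibilityInputs_of_fineQuotient_zeta hfine) W p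

/-! ## Per pair: `BSD(E,3)` at an N2 pair with `3 ∤ #Ш_an`, modulo F1 and published binders -/

/-- **N2 per pair (292 of the 313 cells of record: `ord₃ #Ш(E/ℚ)_an = 0`): Miller's `BSD(E,3)` from F1,
PUBLISHED named facts and finite per-pair certificates ONLY** — GEN 36's
`bsdp_three_of_katoMuTransferThree_of_shaAn_unit_onClassX10b` (p433651) with the node `KatoMuTransferThree`
supplied by `katoMuTransferThree_of_fine hfine` and the Mazur–Tate `σ` by `mazur_tate_sigma_exists_odd_holds`.
Binders left: Schneider 1985 (`hS`, odd `p`), Perrin-Riou (`hPR`, used at `r = 1` only), modular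
parametrisation (`hmodP`), GZK (`hGZK`), the period unit at `3` (`h3`), F1 (`hfine`), Kato Thm. 17.4 at
the pair (`hK`); certificates `hcertA` (one unit coefficient of `L_3(f, α)`; 313/313 on record, three
engines, `class-closure/N2/MUCERT3-x10g36.tsv`), `hunit` (`3 ∤ #Ш_an`); the Schneider rider `hSch` at
`r = 1`.  No flag (Yan–Zhu is not used); nothing booked; the census words are census-lead's.
[cite: Kato2004Asterisque, Thm. 12.6 (p. 222), Thm. 17.4 (2) (p. 273) and §17.13]
[cite: GreenbergLNM1716, §1 Conj. 1.11 and Thm. 4.1 (p. 102)] [cite: PerrinRiou1987, §1.4 Cor. 1.8]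
[cite: Miller2011LMS, Def. 1.1 (arXiv:1010.2431 p. 3)] -/
theorem bsdp_three_of_fine_of_shaAn_unit_onClassX10b (W : WeierstrassCurve ℚ) [W.IsElliptic]
    [W.IsGloballyMinimal]
    (hS : Schneider1985_order_charGenerator_odd) (hPR : perrinRiou_rankOne_leadingTerms_odd)
    (hmodP : nonempty_modularParametrizationData)
    (hGZK : rank_eq_analyticRank_of_analyticRank_le_one)
    (h3 : realPeriodRat_eq_unit_mul_plusPeriod_three) (hfine : exists_divisibilityInputs_fineQuotient_zeta)
    (hK : ∀ (κ : ZpExtension ℚ 3) (γ : Field.absoluteGaloisGroup ℚ) [NeZero (W.conductorNorm ℤ)]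
      (f : CuspForm (Gamma0 (W.conductorNorm ℤ)) 2), kato_divisibility W 3 (κ := κ) (γ := γ) (f := f))
    (hX : ClassX10 W 3) (hns : ¬ Surj W 3)
    (hSch : W.analyticRank = 1 → ∀ Dh : PAdicHeightData W 3, Dh.IsCanonical → SchneiderConjecture Dh)
    (hcertA : ∀ {N : ℕ} [NeZero N] (f : CuspForm (Gamma0 N) 2), IsNewformOf W f →
      ∃ n : ℕ, ‖PowerSeries.coeff n (padicLFunction f (unitRoot W 3 : ℚ_[3]))‖ = 1)
    (hunit : ∃ q : ℚ, shaAn W = (q : ℂ) ∧ padicValRat 3 q = 0) : BSDp W 3 :=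
  bsdp_three_of_katoMuTransferThree_of_shaAn_unit_onClassX10b W hS hPR mazur_tate_sigma_exists_odd_holds
    hmodP hGZK h3 (katoMuTransferThree_of_fine hfine) hK hX hns hSch hcertA hunit

/-- **N2 per pair, Kato Ch. 12 currency**: the same with Kato's Thm. 17.4 at the pair DERIVED from
`Kato2004.thm12_4` and F1 (`kato_divisibility_of_thm12_4_of_fine`) — binders left: Schneider 1985 /
Perrin-Riou (odd `p`), modular parametrisation, GZK, period unit at `3`, Kato Thm. 12.4, F1, the two
certificates and the rank-1 Schneider rider.  Nothing booked.
[cite: Kato2004Asterisque, Thm. 12.4 (p. 221), Thm. 12.6 (p. 222) and §17.13] [cite: Miller2011LMS, Def. 1.1 (arXiv:1010.2431 p. 3)] -/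
theorem bsdp_three_of_thm12_4_of_fine_of_shaAn_unit_onClassX10b (W : WeierstrassCurve ℚ) [W.IsElliptic]
    [W.IsGloballyMinimal]
    (hS : Schneider1985_order_charGenerator_odd) (hPR : perrinRiou_rankOne_leadingTerms_odd)
    (hmodP : nonempty_modularParametrizationData)
    (hGZK : rank_eq_analyticRank_of_analyticRank_le_one)
    (h3 : realPeriodRat_eq_unit_mul_plusPeriod_three) (h12 : thm12_4)
    (hfine : exists_divisibilityInputs_fineQuotient_zeta)
    (hX : ClassX10 W 3) (hns : ¬ Surj W 3)
    (hSch : W.analyticRank = 1 → ∀ Dh : PAdicHeightData W 3, Dh.IsCanonical → SchneiderConjecture Dh)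
    (hcertA : ∀ {N : ℕ} [NeZero N] (f : CuspForm (Gamma0 N) 2), IsNewformOf W f →
      ∃ n : ℕ, ‖PowerSeries.coeff n (padicLFunction f (unitRoot W 3 : ℚ_[3]))‖ = 1)
    (hunit : ∃ q : ℚ, shaAn W = (q : ℂ) ∧ padicValRat 3 q = 0) : BSDp W 3 :=
  bsdp_three_of_fine_of_shaAn_unit_onClassX10b W hS hPR hmodP hGZK h3 hfine
    (fun κ γ _ f => kato_divisibility_of_thm12_4_of_fine h12 hfine W 3 (κ := κ) (γ := γ) (f := f))
    hX hns hSch hcertA hunit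

end Summit.BirchSwinnertonDyer.Rank1Residual.X10

end
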